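import Literature.Analysis.FluidPDE.CKNEpsilonRegularityDivFree
import Literature.Analysis.FluidPDE.CKNEpsilonRegularityUnitScale
import Literature.Analysis.FluidPDE.CKNLocalRegularityRRSPressure
import HarnessLib

/-!
# Lemarié-Rieusset's Theorem 14.4 at unit scale and for solenoidal forces — discharged

Analysis/FluidPDE glue file **discharging the named facts
`Literature.Analysis.FluidPDE.lemarieRieusset_epsilon_regularity_unitScale`**
(`CKNEpsilonRegularityProofs.lean`; P. G. Lemarié-Rieusset, *The Navier–Stokes Problem in the 21st
Century*, Thm. 14.4, the ε-regularity criterion, at unit scale `r₀ = 1`, centre `(0, 0)`) **and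
`Literature.Analysis.FluidPDE.lemarieRieusset_epsilon_regularity_nu_one_divFree`**
(`CKNEpsilonRegularityDivFree.lean`; Thm. 14.4 at `ν = 1`, `r₀ = 1` for solenoidal forces). The
accepted tree reductions are `lemarieRieusset_epsilon_regularity_unitScale_of_lemma15_12`
(`CKNEpsilonRegularityUnitScale.lean`) and
`lemarieRieusset_epsilon_regularity_nu_one_divFree_of_lemma15_12` (`CKNEpsilonRegularityDivFree.lean`),
both from Robinson–Rodrigo–Sadowski's Lemma 15.12, which is discharged
(`RRS2016.lemma15_12_holds`, `CKNLocalRegularityRRSPressure.lean`). The general statement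
`lemarieRieusset_epsilon_regularity` and its `ν = 1` and solenoidal variants are already
discharged in `CKNEpsilonRegularityHolds.lean`; this file closes the two remaining named
normalised forms.

Theorem-only glue module: no definitions, no named facts, no `sorry`; each theorem is a
composition of an accepted tree reduction with accepted discharges (pure proof of an
unchanged statement).

## References

* P. G. Lemarié-Rieusset, *The Navier–Stokes Problem in the 21st Century*, CRC Press (2016),
  Thm. 14.4, p. 505 [LemarieRieusset2016]; 2nd ed. (2023), §14.3 Thm. 14.4 [Lemarierieusset2023].
* J. C. Robinson, J. L. Rodrigo, W. Sadowski, *The Three-Dimensional Navier–Stokes Equations*,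
  CUP (2016), Lemma 15.12. [RobinsonRodrigoSadowski2016]
-/

noncomputable section

namespace Literature.Analysis.FluidPDE

/-- **Thm. 14.4 at unit scale, proved** (the named statement
`lemarieRieusset_epsilon_regularity_unitScale`), by
`lemarieRieusset_epsilon_regularity_unitScale_of_lemma15_12` and `RRS2016.lemma15_12_holds`. [cite: Lemarierieusset2023, §14.3 Thm. 14.4 (scan p. 505), case r₀ = 1] -/
theorem lemarieRieusset_epsilon_regularity_unitScale_holds : lemarieRieusset_epsilon_regularity_unitScale :=
  lemarieRieusset_epsilon_regularity_unitScale_of_lemma15_12 RRS2016.lemma15_12_holds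

/-- **Thm. 14.4 for solenoidal forces at `ν = 1`, `r₀ = 1`, proved** (the named statement
`lemarieRieusset_epsilon_regularity_nu_one_divFree`), by
`lemarieRieusset_epsilon_regularity_nu_one_divFree_of_lemma15_12` and `RRS2016.lemma15_12_holds`. [cite: LemarieRieusset2016, Thm. 14.4 p. 505, case ν = 1, r₀ = 1, solenoidal force] -/
theorem lemarieRieusset_epsilon_regularity_nu_one_divFree_holds : lemarieRieusset_epsilon_regularity_nu_one_divFree :=
  lemarieRieusset_epsilon_regularity_nu_one_divFree_of_lemma15_12 RRS2016.lemma15_12_holds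

end Literature.Analysis.FluidPDE
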